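import Summits.CriticalPhenomena.PercolationContinuityZ3.Theorems.PercNearOneGluingNoHeavyLowerTailAntitheticPendant
import HarnessLib

/-!
# `NoHeavyLowerTail` (stmt-CriticalPhenomena-4575) — antithetic cluster pairs: tools for the CUT-VERTEX (block-gluing) theorem
# (prim-hp-2 gen 39; HOME/MEMO-gen39-pendant.md §2)

Support file (`--supports stmt-CriticalPhenomena-4575`, hull-port prover `prim-hp-2`, gen 39).  No named facts, no sorries; standard axioms.  The
`def` `Antithetic.Glue.lift` is proof-internal bookkeeping.

SETTING.  Two edge sets `E₁, E₂` GLUED AT ONE VERTEX `a`: every vertex common to a pair of `E₁` and a pair of `E₂` is `a` (`hsep`); the source `s`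
lies on the `E₁` side (`hs`: a pair of `E₂` contains `s` only if `s = a`; `s = a` is allowed).  Colourings `ω` (`ω ∩ E` red, `ωᶜ ∩ E` blue).
* GRAPH (`Glue.reach_trichotomy`, `reach_side_one`, `reach_side_two`, `openEdgeCluster_union`): a walk of `E₁ ∪ E₂` passes from one side to the
  other only through `a`; hence a vertex of the `E₁` side is reached from `s` in `E₁ ∪ E₂` iff it is reached in `E₁`, a vertex `v ≠ a` of the
  `E₂` side iff `a` is reached in `E₁` and `v` is reached from `a` in `E₂`, and the edge cluster splits as
  `C_s(ω ∩ (E₁ ∪ E₂)) = C_s(ω ∩ E₁) ∪ [a reached in ω ∩ E₁] · C_a(ω ∩ E₂)` (`= Glue.lift s a (C_a(ω ∩ E₂)) (C_s(ω ∩ E₁))`).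
* `Glue.lift s a S C = C ∪ S` if `a = s` or `a` is an endpoint of an edge of `C`, else `C`; increasing in `C` and in `S`.
* FIBRES (`Glue.sum_slab_eq`, `Glue.fiber_nonneg`): for a summand `g θ ω` that ignores the `K`-part of `ω` and sees `θ` only through `θ ∩ K`,
  `Σ_ω g ω ω ≥ 0` as soon as `Σ_ω g θ ω ≥ 0` for every `θ` (the sum over each slab `{ω : ω ∩ K = θ}` is `2^{-|K|}` of the full sum).
[cite: VandenbergHaggstromKahn2005, §1 p. 3 (open cluster `C_s`)]
-/

noncomputable section

namespace Summit.CriticalPhenomena.PercolationContinuityZ3.Theorems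

open Literature.Probability.Percolation
open scoped Classical symmDiff

namespace Antithetic

namespace Glue

variable {V : Type*}

section Graph

variable (η : Set (Sym2 V))

/-- A vertex joined to a different vertex meets a pair of the configuration. [folklore] -/
theorem exists_pair_of_reachable {u v : V} (huv : u ≠ v) (h : (openGraph η).Reachable u v) : ∃ w, s(u, w) ∈ η ∧ u ≠ w := by
  obtain ⟨p⟩ := h
  cases p with
  | nil => exact absurd rfl huv
  | cons hadj _ =>
    rw [openGraph_adj] at hadj
    exact ⟨_, hadj.1, hadj.2⟩

/-- The red graph of `E₁` is a subgraph of the red graph of `E₁ ∪ E₂`. [folklore] -/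
theorem le_union_left (ω E₁ E₂ : Set (Sym2 V)) : openGraph (ω ∩ E₁) ≤ openGraph (ω ∩ (E₁ ∪ E₂)) :=
  SimpleGraph.fromEdgeSet_mono (Set.inter_subset_inter_right ω Set.subset_union_left)

/-- The red graph of `E₂` is a subgraph of the red graph of `E₁ ∪ E₂`. [folklore] -/
theorem le_union_right (ω E₁ E₂ : Set (Sym2 V)) : openGraph (ω ∩ E₂) ≤ openGraph (ω ∩ (E₁ ∪ E₂)) :=
  SimpleGraph.fromEdgeSet_mono (Set.inter_subset_inter_right ω Set.subset_union_right)

variable (E₁ E₂ : Set (Sym2 V)) (a : V) (ω : Set (Sym2 V))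

/-- **Cut-vertex trichotomy**: a walk in a colouring of `E₁ ∪ E₂` (glued at `a`) stays in `E₁`, stays in `E₂`, or passes through `a`. [folklore] -/
theorem reach_trichotomy (hsep : ∀ e₁ ∈ E₁, ∀ e₂ ∈ E₂, ∀ v : V, v ∈ e₁ → v ∈ e₂ → v = a) {u v : V}
    (h : (openGraph (ω ∩ (E₁ ∪ E₂))).Reachable u v) :
    (openGraph (ω ∩ E₁)).Reachable u v ∨ (openGraph (ω ∩ E₂)).Reachable u v ∨
      (((openGraph (ω ∩ E₁)).Reachable u a ∨ (openGraph (ω ∩ E₂)).Reachable u a) ∧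
        ((openGraph (ω ∩ E₁)).Reachable a v ∨ (openGraph (ω ∩ E₂)).Reachable a v)) := by
  -- a vertex `≠ a` meeting an open pair of `E₁` is not joined inside `E₂` to a different vertex, and symmetrically
  have key₁ : ∀ u' w z, s(u', w) ∈ E₁ → u' ≠ z → (openGraph (ω ∩ E₂)).Reachable u' z → u' = a := by
    intro u' w z h1 hne h2
    obtain ⟨w', hw', -⟩ := exists_pair_of_reachable (ω ∩ E₂) hne h2
    exact hsep _ h1 _ hw'.2 u' (Sym2.mem_mk_left _ _) (Sym2.mem_mk_left _ _)
  have key₂ : ∀ u' w z, s(u', w) ∈ E₂ → u' ≠ z → (openGraph (ω ∩ E₁)).Reachable u' z → u' = a := by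
    intro u' w z h2 hne h1
    obtain ⟨w', hw', -⟩ := exists_pair_of_reachable (ω ∩ E₁) hne h1
    exact hsep _ hw'.2 _ h2 u' (Sym2.mem_mk_left _ _) (Sym2.mem_mk_left _ _)
  obtain ⟨p⟩ := h
  induction p with
  | nil => exact Or.inl (SimpleGraph.Reachable.refl _)
  | cons hadj p ih =>
    rename_i u u' v
    rw [openGraph_adj] at hadj
    obtain ⟨⟨hω, hE | hE⟩, hne⟩ := hadj
    · have h1 : (openGraph (ω ∩ E₁)).Reachable u u' := ((openGraph_adj (ω ∩ E₁) u u').2 ⟨⟨hω, hE⟩, hne⟩).reachable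
      have hE' : s(u', u) ∈ E₁ := by rw [Sym2.eq_swap]; exact hE
      rcases ih with h | h | ⟨hl, hr⟩
      · exact Or.inl (h1.trans h)
      · by_cases huv : u' = v
        · subst huv; exact Or.inl h1
        · have := key₁ u' u v hE' huv h
          subst this
          exact Or.inr (Or.inr ⟨Or.inl h1, Or.inr h⟩)
      · rcases hl with hl | hl
        · exact Or.inr (Or.inr ⟨Or.inl (h1.trans hl), hr⟩)
        · by_cases hua : u' = a
          · subst hua; exact Or.inr (Or.inr ⟨Or.inl h1, hr⟩)
          · exact absurd (key₁ u' u a hE' hua hl) hua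
    · have h2 : (openGraph (ω ∩ E₂)).Reachable u u' := ((openGraph_adj (ω ∩ E₂) u u').2 ⟨⟨hω, hE⟩, hne⟩).reachable
      have hE' : s(u', u) ∈ E₂ := by rw [Sym2.eq_swap]; exact hE
      rcases ih with h | h | ⟨hl, hr⟩
      · by_cases huv : u' = v
        · subst huv; exact Or.inr (Or.inl h2)
        · have := key₂ u' u v hE' huv h
          subst this
          exact Or.inr (Or.inr ⟨Or.inr h2, Or.inl h⟩)
      · exact Or.inr (Or.inl (h2.trans h))
      · rcases hl with hl | hl
        · by_cases hua : u' = a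
          · subst hua; exact Or.inr (Or.inr ⟨Or.inr h2, hr⟩)
          · exact absurd (key₂ u' u a hE' hua hl) hua
        · exact Or.inr (Or.inr ⟨Or.inr (h2.trans hl), hr⟩)

variable {E₁ E₂ a ω} (s : V)

/-- **Side one**: a vertex `v` meeting pairs of `E₂` only if `v = a` is reached from `s` in `E₁ ∪ E₂` iff it is reached in `E₁`. [this work] -/
theorem reach_side_one (hsep : ∀ e₁ ∈ E₁, ∀ e₂ ∈ E₂, ∀ v : V, v ∈ e₁ → v ∈ e₂ → v = a) (hs : ∀ e ∈ E₂, s ∈ e → s = a)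
    {v : V} (hv : ∀ e ∈ E₂, v ∈ e → v = a) :
    (openGraph (ω ∩ (E₁ ∪ E₂))).Reachable s v ↔ (openGraph (ω ∩ E₁)).Reachable s v := by
  have side : ∀ u z, (∀ e ∈ E₂, u ∈ e → u = a) → (openGraph (ω ∩ E₂)).Reachable u z → u ≠ z → u = a := fun u z hu h hne => by
    obtain ⟨w, hw, -⟩ := exists_pair_of_reachable (ω ∩ E₂) hne h
    exact hu _ hw.2 (Sym2.mem_mk_left _ _)
  refine ⟨fun h => ?_, fun h => h.mono (le_union_left ω E₁ E₂)⟩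
  -- `R₂ s z` forces `s = a` (or `s = z`), `R₂ a v` forces `v = a` (or ...)
  have hsa : (openGraph (ω ∩ E₂)).Reachable s a → (openGraph (ω ∩ E₁)).Reachable s a := fun h2 => by
    by_cases hsa : s = a
    · rw [hsa]
    · exact absurd (side s a hs h2 hsa) hsa
  have hav : (openGraph (ω ∩ E₂)).Reachable a v → (openGraph (ω ∩ E₁)).Reachable a v := fun h2 => by
    by_cases hva : v = a
    · rw [hva]
    · exact absurd (side v a hv h2.symm hva) hva
  rcases reach_trichotomy E₁ E₂ a ω hsep h with h1 | h2 | ⟨hl, hr⟩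
  · exact h1
  · by_cases hsv : s = v
    · rw [hsv]
    · have h1 := side s v hs h2 hsv
      have h2' := side v s hv h2.symm (Ne.symm hsv)
      rw [h1, h2']
  · exact (hl.elim id hsa).trans (hr.elim id hav)

/-- **Side two**: a vertex `v ≠ a` meeting a pair of `E₂` is reached from `s` in `E₁ ∪ E₂` iff `a` is reached from `s` in `E₁` and `v` from `a` in
`E₂`. [this work] -/
theorem reach_side_two (hsep : ∀ e₁ ∈ E₁, ∀ e₂ ∈ E₂, ∀ v : V, v ∈ e₁ → v ∈ e₂ → v = a) (hs : ∀ e ∈ E₂, s ∈ e → s = a)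
    {v : V} (hva : v ≠ a) {e : Sym2 V} (he : e ∈ E₂) (hve : v ∈ e) :
    (openGraph (ω ∩ (E₁ ∪ E₂))).Reachable s v ↔ (openGraph (ω ∩ E₁)).Reachable s a ∧ (openGraph (ω ∩ E₂)).Reachable a v := by
  have hv1 : ∀ e₁ ∈ E₁, v ∉ e₁ := fun e₁ he₁ hv => hva (hsep e₁ he₁ e he v hv hve)
  have no1 : ∀ u, (openGraph (ω ∩ E₁)).Reachable u v → u = v := fun u h => by
    by_contra hne
    obtain ⟨w, hw, -⟩ := exists_pair_of_reachable (ω ∩ E₁) (Ne.symm hne) h.symm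
    exact hv1 _ hw.2 (Sym2.mem_mk_left _ _)
  have hsv : s ≠ v := fun h => hva (h ▸ (hs e he (h ▸ hve)))
  have hsa2 : (openGraph (ω ∩ E₂)).Reachable s a → s = a := fun h2 => by
    by_contra hsa
    obtain ⟨w, hw, -⟩ := exists_pair_of_reachable (ω ∩ E₂) hsa h2
    exact hsa (hs _ hw.2 (Sym2.mem_mk_left _ _))
  constructor
  · intro h
    rcases reach_trichotomy E₁ E₂ a ω hsep h with h1 | h2 | ⟨hl, hr⟩
    · exact absurd (no1 s h1) hsv
    · obtain ⟨w, hw, -⟩ := exists_pair_of_reachable (ω ∩ E₂) hsv h2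
      have hsa : s = a := hs _ hw.2 (Sym2.mem_mk_left _ _)
      subst hsa
      exact ⟨SimpleGraph.Reachable.refl _, h2⟩
    · have hl' : (openGraph (ω ∩ E₁)).Reachable s a := by
        rcases hl with hl | hl
        · exact hl
        · rw [hsa2 hl]
      rcases hr with hr | hr
      · exact absurd (no1 a hr) (Ne.symm hva)
      · exact ⟨hl', hr⟩
  · rintro ⟨h1, h2⟩
    exact (h1.mono (le_union_left ω E₁ E₂)).trans (h2.mono (le_union_right ω E₁ E₂))

end Graph

/-- `lift s a S C`: the cluster `C` with the edge set `S` adjoined when `a` is reached by `C` (`a = s` or `a` an endpoint of an edge of `C`).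
[this work] -/
def lift (s a : V) (S C : Set (Sym2 V)) : Set (Sym2 V) :=
  if a = s ∨ ∃ f ∈ C, a ∈ f then C ∪ S else C

section Lift

variable (s a : V)

/-- `lift` is increasing in the cluster. [this work] -/
theorem lift_mono_right (S : Set (Sym2 V)) : Monotone (lift s a S) := by
  intro C D hCD
  change lift s a S C ⊆ lift s a S D
  unfold lift
  by_cases hC : a = s ∨ ∃ f ∈ C, a ∈ f
  · have hD : a = s ∨ ∃ f ∈ D, a ∈ f := hC.imp id fun ⟨f, hf, haf⟩ => ⟨f, hCD hf, haf⟩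
    rw [if_pos hC, if_pos hD]
    exact Set.union_subset_union_left _ hCD
  · rw [if_neg hC]; split_ifs; exacts [hCD.trans Set.subset_union_left, hCD]

/-- `lift` is increasing in the adjoined set. [this work] -/
theorem lift_mono_left (C : Set (Sym2 V)) : Monotone fun S => lift s a S C := by
  intro S S' hSS'
  change lift s a S C ⊆ lift s a S' C
  unfold lift; split_ifs; exacts [Set.union_subset_union_right _ hSS', le_rfl]

/-- `C ⊆ lift S C`. [this work] -/
theorem subset_lift (S C : Set (Sym2 V)) : C ⊆ lift s a S C := by
  unfold lift; split_ifs; exacts [Set.subset_union_left, le_rfl]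

end Lift

section ClusterSplit

variable {E₁ E₂ : Set (Sym2 V)} {a : V} (s : V) (ω : Set (Sym2 V))

/-- **The edge cluster across a cut vertex**: `C_s(ω ∩ (E₁ ∪ E₂)) = lift s a (C_a(ω ∩ E₂)) (C_s(ω ∩ E₁))`. [this work] -/
theorem openEdgeCluster_union (hsep : ∀ e₁ ∈ E₁, ∀ e₂ ∈ E₂, ∀ v : V, v ∈ e₁ → v ∈ e₂ → v = a) (hs : ∀ e ∈ E₂, s ∈ e → s = a) :
    openEdgeCluster (ω ∩ (E₁ ∪ E₂)) s = lift s a (openEdgeCluster (ω ∩ E₂) a) (openEdgeCluster (ω ∩ E₁) s) := by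
  have hρ : (a = s ∨ ∃ f ∈ openEdgeCluster (ω ∩ E₁) s, a ∈ f) ↔ (openGraph (ω ∩ E₁)).Reachable s a :=
    (Pendant.reachable_iff_cluster (ω ∩ E₁) a s).symm
  have ha1 : ∀ e ∈ E₂, a ∈ e → a = a := fun _ _ _ => rfl
  ext e
  rw [mem_openEdgeCluster_iff]
  constructor
  · rintro ⟨⟨heω, he⟩, hd, hr⟩
    rcases he with he | he
    · -- an `E₁` edge: its endpoints meet `E₂` only at `a`
      have hmem : e ∈ openEdgeCluster (ω ∩ E₁) s :=
        ⟨⟨heω, he⟩, hd, fun v hv => (reach_side_one s hsep hs (fun e₂ he₂ hv₂ => hsep e he e₂ he₂ v hv hv₂)).1 (hr v hv)⟩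
      exact subset_lift s a _ _ hmem
    · -- an `E₂` edge: `a` is reached in `E₁` and the endpoints are reached from `a` in `E₂`
      have key : ∀ v ∈ e, (openGraph (ω ∩ E₁)).Reachable s a ∧ (openGraph (ω ∩ E₂)).Reachable a v := by
        intro v hv
        by_cases hva : v = a
        · subst hva
          exact ⟨(reach_side_one s hsep hs ha1).1 (hr v hv), SimpleGraph.Reachable.refl _⟩
        · exact (reach_side_two s hsep hs hva he hv).1 (hr v hv)
      obtain ⟨p, hp⟩ : ∃ p, p ∈ e := ⟨e.out.1, Sym2.out_fst_mem e⟩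
      unfold lift
      rw [if_pos (hρ.2 (key p hp).1)]
      exact Or.inr ⟨⟨heω, he⟩, hd, fun v hv => (key v hv).2⟩
  · intro h
    unfold lift at h
    by_cases hc : a = s ∨ ∃ f ∈ openEdgeCluster (ω ∩ E₁) s, a ∈ f
    · rw [if_pos hc] at h
      have hsa := hρ.1 hc
      rcases h with ⟨⟨heω, he⟩, hd, hr⟩ | ⟨⟨heω, he⟩, hd, hr⟩
      · exact ⟨⟨heω, Or.inl he⟩, hd, fun v hv => (hr v hv).mono (le_union_left ω E₁ E₂)⟩
      · exact ⟨⟨heω, Or.inr he⟩, hd, fun v hv => (hsa.mono (le_union_left ω E₁ E₂)).trans ((hr v hv).mono (le_union_right ω E₁ E₂))⟩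
    · rw [if_neg hc] at h
      obtain ⟨⟨heω, he⟩, hd, hr⟩ := h
      exact ⟨⟨heω, Or.inl he⟩, hd, fun v hv => (hr v hv).mono (le_union_left ω E₁ E₂)⟩

end ClusterSplit

section Fibers

variable [Fintype V]

/-- All slabs `{ω : ω ∩ K = θ}` (`θ ⊆ K`) carry the same sum of a summand that ignores the `K`-part of `ω`. [folklore] -/
theorem sum_slab_eq (K : Set (Sym2 V)) (h : Set (Sym2 V) → ℝ) (hh : ∀ ω D : Set (Sym2 V), D ⊆ K → h (ω ∆ D) = h ω)
    {θ θ' : Set (Sym2 V)} (hθ : θ ⊆ K) (hθ' : θ' ⊆ K) :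
    ∑ ω ∈ Finset.univ.filter (fun ω : Set (Sym2 V) => ω ∩ K = θ), h ω =
      ∑ ω ∈ Finset.univ.filter (fun ω : Set (Sym2 V) => ω ∩ K = θ'), h ω := by
  set D : Set (Sym2 V) := θ ∆ θ' with hD
  have hDK : D ⊆ K := fun e he => by
    rcases Set.mem_symmDiff.1 he with h | h
    exacts [hθ h.1, hθ' h.1]
  have hinv : Function.Involutive fun ω : Set (Sym2 V) => ω ∆ D := fun ω => symmDiff_symmDiff_cancel_right _ _
  have hslab : ∀ ω : Set (Sym2 V), (ω ∆ D) ∩ K = θ ↔ ω ∩ K = θ' := by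
    intro ω
    rw [Set.inter_symmDiff_distrib_right, Set.inter_eq_left.2 hDK]
    constructor
    · intro h'
      have h2 : ω ∩ K = θ ∆ D := by rw [← h', symmDiff_symmDiff_cancel_right]
      rw [h2, hD, symmDiff_symmDiff_cancel_left]
    · intro h'
      rw [h', hD, symmDiff_comm θ' (θ ∆ θ'), symmDiff_symmDiff_cancel_right]
  rw [Finset.sum_filter, Finset.sum_filter]
  rw [← Fintype.sum_equiv (Function.Involutive.toPerm _ hinv) (fun ω => if (ω ∆ D) ∩ K = θ then h (ω ∆ D) else 0)
    (fun ω => if ω ∩ K = θ then h ω else 0) (fun ω => rfl)]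
  refine Finset.sum_congr rfl fun ω _ => ?_
  rw [hh ω D hDK]
  simp only [hslab]

/-- **Fibre principle**: if `g θ ω` ignores the `K`-part of `ω`, sees `θ` only through `θ ∩ K`, and has nonnegative sum over `ω` for every
`θ ⊆ K`, then the diagonal sum `Σ_ω g ω ω` is nonnegative. [this work] -/
theorem fiber_nonneg (K : Set (Sym2 V)) (g : Set (Sym2 V) → Set (Sym2 V) → ℝ)
    (hD : ∀ θ ω D : Set (Sym2 V), D ⊆ K → g θ (ω ∆ D) = g θ ω) (hK : ∀ θ ω, g θ ω = g (θ ∩ K) ω)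
    (hpos : ∀ θ, θ ⊆ K → 0 ≤ ∑ ω, g θ ω) : 0 ≤ ∑ ω, g ω ω := by
  have hfib := Finset.sum_fiberwise_of_maps_to (s := (Finset.univ : Finset (Set (Sym2 V)))) (t := Finset.univ)
    (g := fun ω : Set (Sym2 V) => ω ∩ K) (fun _ _ => Finset.mem_univ _) (fun ω => g ω ω)
  rw [← hfib]
  refine Finset.sum_nonneg fun θ _ => ?_
  -- the fibre over `θ`
  by_cases hne : (Finset.univ.filter fun ω : Set (Sym2 V) => ω ∩ K = θ).Nonempty
  swap
  · rw [Finset.not_nonempty_iff_eq_empty.1 hne, Finset.sum_empty]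
  obtain ⟨ω₀, hω₀⟩ := hne
  have hθ : θ ⊆ K := by
    rw [Finset.mem_filter] at hω₀
    rw [← hω₀.2]; exact Set.inter_subset_right
  have hdiag : ∑ ω ∈ Finset.univ.filter (fun ω : Set (Sym2 V) => ω ∩ K = θ), g ω ω =
      ∑ ω ∈ Finset.univ.filter (fun ω : Set (Sym2 V) => ω ∩ K = θ), g θ ω := by
    refine Finset.sum_congr rfl fun ω hω => ?_
    rw [Finset.mem_filter] at hω
    rw [hK ω ω, hω.2]
  rw [hdiag]
  -- every slab over a subset of `K` has the same sum `S`; the slabs over subsets of `K` exhaust everything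
  set S := ∑ ω ∈ Finset.univ.filter (fun ω : Set (Sym2 V) => ω ∩ K = θ), g θ ω with hS
  have hslabs : ∀ θ' : Set (Sym2 V), ∑ ω ∈ Finset.univ.filter (fun ω : Set (Sym2 V) => ω ∩ K = θ'), g θ ω =
      if θ' ⊆ K then S else 0 := by
    intro θ'
    split_ifs with hθ'
    · exact sum_slab_eq K (g θ) (hD θ) hθ' hθ
    · refine Finset.sum_eq_zero fun ω hω => ?_
      rw [Finset.mem_filter] at hω
      exact absurd (hω.2 ▸ Set.inter_subset_right) hθ'
  have htot := Finset.sum_fiberwise_of_maps_to (s := (Finset.univ : Finset (Set (Sym2 V)))) (t := Finset.univ)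
    (g := fun ω : Set (Sym2 V) => ω ∩ K) (fun _ _ => Finset.mem_univ _) (fun ω => g θ ω)
  simp only [hslabs] at htot
  rw [Finset.sum_ite, Finset.sum_const_zero, add_zero, Finset.sum_const, nsmul_eq_mul] at htot
  have hcard : (0 : ℝ) < (Finset.univ.filter fun θ' : Set (Sym2 V) => θ' ⊆ K).card := by
    exact_mod_cast Finset.card_pos.2 ⟨θ, Finset.mem_filter.2 ⟨Finset.mem_univ _, hθ⟩⟩
  have h0 : 0 ≤ ((Finset.univ.filter fun θ' : Set (Sym2 V) => θ' ⊆ K).card : ℝ) * S := by rw [htot]; exact hpos θ hθ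
  exact le_of_mul_le_mul_left (by rw [mul_zero]; exact h0) hcard

end Fibers

section SetLemmas

variable (E : Set (Sym2 V)) (ω : Set (Sym2 V))

/-- Reflecting pairs outside `E` does not change the colouring of `E`. [folklore] -/
theorem symmDiff_inter_eq {D : Set (Sym2 V)} (hD : ∀ e ∈ D, e ∉ E) : (ω ∆ D) ∩ E = ω ∩ E := by
  ext f
  simp only [Set.mem_inter_iff, Set.mem_symmDiff]
  constructor
  · rintro ⟨h | h, hf⟩
    exacts [⟨h.1, hf⟩, absurd hf (hD f h.1)]
  · exact fun ⟨h, hf⟩ => ⟨Or.inl ⟨h, fun h' => hD f h' hf⟩, hf⟩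

/-- Reflecting pairs outside `E` does not change the complementary colouring of `E`. [folklore] -/
theorem compl_symmDiff_inter_eq {D : Set (Sym2 V)} (hD : ∀ e ∈ D, e ∉ E) : (ω ∆ D)ᶜ ∩ E = ωᶜ ∩ E := by
  ext f
  simp only [Set.mem_inter_iff, Set.mem_compl_iff, Set.mem_symmDiff, not_or, not_and, not_not]
  exact ⟨fun ⟨⟨h1, _⟩, hf⟩ => ⟨fun h => hD f (h1 h) hf, hf⟩, fun ⟨h, hf⟩ => ⟨⟨fun h' => absurd h' h, fun h' => absurd hf (hD f h')⟩, hf⟩⟩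

/-- Reflecting all pairs of `E` swaps the two colourings of `E`. [folklore] -/
theorem symmDiff_self_inter_eq : (ω ∆ E) ∩ E = ωᶜ ∩ E := by
  ext f
  simp only [Set.mem_inter_iff, Set.mem_symmDiff, Set.mem_compl_iff]
  tauto

/-- Reflecting all pairs of `E` swaps the two colourings of `E` (complementary form). [folklore] -/
theorem compl_symmDiff_self_inter_eq : (ω ∆ E)ᶜ ∩ E = ω ∩ E := by
  ext f
  simp only [Set.mem_inter_iff, Set.mem_compl_iff, Set.mem_symmDiff]
  tauto

/-- The constraint set of `T_E(R,X)` sees a colouring only through its two traces on `E`. [this work] -/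
theorem mem_tset_congr [Fintype V] (s : V) (R X : Set V) {ω ω' : Set (Sym2 V)} (h1 : ω ∩ E = ω' ∩ E) (h2 : ωᶜ ∩ E = ω'ᶜ ∩ E) :
    ω ∈ Peel.tset E s R X ↔ ω' ∈ Peel.tset E s R X := by
  rw [Peel.mem_tset, Peel.mem_tset, h1, h2]

/-- The constraint set of `T_E(R,∅)` is symmetric under swapping the two colourings of `E`. [this work] -/
theorem mem_tset_swap [Fintype V] (s : V) (R : Set V) {ω ω' : Set (Sym2 V)} (h1 : ω ∩ E = ω'ᶜ ∩ E) (h2 : ωᶜ ∩ E = ω' ∩ E) :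
    ω ∈ Peel.tset E s R ∅ ↔ ω' ∈ Peel.tset E s R ∅ := by
  rw [Peel.mem_tset, Peel.mem_tset, h1, h2]
  simp only [Set.mem_empty_iff_false, false_implies, implies_true, and_true]
  exact forall₂_congr fun r _ => by rw [and_comm]

/-- The functional `Δ_E` sees a colouring only through its two traces on `E`. [this work] -/
theorem delta_congr (F G : Set (Sym2 V) → ℝ) (s : V) {ω ω' : Set (Sym2 V)} (h1 : ω ∩ E = ω' ∩ E) (h2 : ωᶜ ∩ E = ω'ᶜ ∩ E) :
    Peel.delta F G E s ω = Peel.delta F G E s ω' := by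
  unfold Peel.delta; rw [h1, h2]

/-- A filtered sum as a sum of an indicator. [folklore] -/
theorem sum_mem_eq_sum_ite [Fintype V] (t : Finset (Set (Sym2 V))) (f : Set (Sym2 V) → ℝ) :
    ∑ ω ∈ t, f ω = ∑ ω, if ω ∈ t then f ω else 0 := by
  rw [Finset.sum_ite_mem, Finset.univ_inter]

end SetLemmas

end Glue

end Antithetic

end Summit.CriticalPhenomena.PercolationContinuityZ3.Theorems
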